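import Mathlib.Combinatorics.SimpleGraph.Metric
import Mathlib.Combinatorics.SimpleGraph.Acyclic

/-!
# Geodesics in trees and the fixed point of a finite group action ([SemiAnbd] §1, Lemma 1.8, p. 20)

Mochizuki, *Semi-graphs of anabelioids*, Publ. RIMS **42** (2006) 221–322, §1, author's manuscript
p. 20 [cite: MochizukiSemiAnbd2006, Lem. 1.8 p.20]: Lemma 1.8 (finite group actions on
semi-graphs and trees) is "implicit in the theory of [Serre]" (Serre, *Trees*).  This proof-only file
(no definitions) supplies the elementary geometry of geodesics in a tree, phrased for an arbitrary
`SimpleGraph` (it is applied to the barycentric subdivision of a semi-graph in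
`FreeGroupsAndActionsProofs2.lean`):

* no peaks: along a path of an acyclic graph the distance from a fixed node `o` has no strict local
  maximum (`eq_of_dist_eq_succ_of_adj`), hence once it increases it keeps increasing
  (`dist_eq_add_length_of_dist_snd`), hence an interior node of a path is strictly closer to `o`
  than the farther end-point (`dist_lt_max_of_mem_support`);
* an interior node of a path has two distinct neighbours on it (`exists_adj_adj_of_mem_support`);
* the fixed-point theorem for a finite group acting on a tree (`exists_forall_act_eq_or_adj`): a
  node minimising the radius of an orbit is moved by every group element to itself or to a
  neighbour — the combinatorial core of Lemma 1.8 (ii)(a);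
* `exists_geodesic_through_of_min`: if the distance from `o` is minimal at the start of a geodesic,
  the start lies on a geodesic from `o` to the end (used for Lemma 1.8 (ii)(c)).

Deliberately NOT here: anything about semi-graphs; midpoints / centres of trees as objects.
-/

namespace Literature.AnabelianGeometry.SemiGraphs

open SimpleGraph

variable {V : Type*} {S : SimpleGraph V}

/-- In an acyclic graph, if `dist o b = dist o a + 1` for neighbours `a ~ b` with `a` reachable from
`o`, then every geodesic from `o` to `b` enters `b` through `a`. [cite: MochizukiSemiAnbd2006, Lem. 1.8 p.20] -/
theorem penultimate_eq_of_dist_eq_succ (hS : S.IsAcyclic) {o a b : V} (hab : S.Adj a b)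
    (hoa : S.Reachable o a) {q : S.Walk o b} (hq : q.IsPath) (hql : q.length = S.dist o b)
    (h : S.dist o b = S.dist o a + 1) : q.penultimate = a := by
  obtain ⟨p, hp, hpl⟩ := hoa.exists_path_of_dist
  by_cases hb : b ∈ p.support
  · have hpq : p = q.concat hab.symm := hS.path_concat hq hp hab.symm hb
    have hlen : p.length = q.length + 1 := by rw [hpq, Walk.length_concat]
    omega
  · have ha : a ∈ q.support :=
      hS.mem_support_of_ne_mem_support_of_adj_of_isPath hq hp hab.symm hb
    have hqp : q = p.concat hab := hS.path_concat hp hq hab ha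
    rw [hqp, Walk.penultimate_concat]

/-- No peaks: in an acyclic graph the distance from a fixed node cannot have a strict local maximum
at a node `b` with two distinct neighbours `a`, `c`. [cite: MochizukiSemiAnbd2006, Lem. 1.8 p.20] -/
theorem eq_of_dist_eq_succ_of_adj (hS : S.IsAcyclic) {o a b c : V} (hab : S.Adj a b)
    (hcb : S.Adj c b) (hoa : S.Reachable o a) (hoc : S.Reachable o c)
    (ha : S.dist o b = S.dist o a + 1) (hc : S.dist o b = S.dist o c + 1) : a = c := by
  obtain ⟨q, hq, hql⟩ := (hoa.trans hab.reachable).exists_path_of_dist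
  rw [← penultimate_eq_of_dist_eq_succ hS hab hoa hq hql ha,
    ← penultimate_eq_of_dist_eq_succ hS hcb hoc hq hql hc]

/-- Monotonicity along paths in a tree: if the distance from `o` increases along the first edge of a
path, it increases along every edge of the path. [cite: MochizukiSemiAnbd2006, Lem. 1.8 p.20] -/
theorem dist_eq_add_length_of_dist_snd (hS : S.IsTree) (o : V) {x y : V} (p : S.Walk x y)
    (hp : p.IsPath) (h1 : S.dist o p.snd = S.dist o x + 1) :
    S.dist o y = S.dist o x + p.length := by
  induction p with
  | nil => simp at h1
  | @cons x x₁ y hx p' ih =>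
    rw [Walk.snd_cons] at h1
    rw [Walk.cons_isPath_iff] at hp
    cases p' with
    | nil => simpa using h1
    | @cons _ x₂ _ hx₁ p'' =>
      have h2 : S.dist o x₂ = S.dist o x₁ + 1 := by
        rcases hS.dist_eq_dist_add_one_of_adj o hx₁ with h | h
        · exfalso
          have hne : x ≠ x₂ := by
            rintro rfl
            exact hp.2 (by simp)
          exact hne (eq_of_dist_eq_succ_of_adj hS.isAcyclic hx hx₁.symm (hS.connected o x)
            (hS.connected o x₂) h1 h)
        · exact h
      have h3 := ih hp.1 (by rw [Walk.snd_cons]; exact h2)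
      rw [Walk.length_cons, Walk.length_cons] at *
      omega

/-- Strict convexity of the distance along geodesics of a tree: an interior node of a path is
strictly closer to any node `o` than the farther of the two endpoints.
[cite: MochizukiSemiAnbd2006, Lem. 1.8 p.20] -/
theorem dist_lt_max_of_mem_support (hS : S.IsTree) (o : V) {x y : V} (p : S.Walk x y)
    (hp : p.IsPath) {z : V} (hz : z ∈ p.support) (hzx : z ≠ x) (hzy : z ≠ y) :
    S.dist o z < max (S.dist o x) (S.dist o y) := by
  induction p with
  | nil =>
    rw [Walk.support_nil, List.mem_singleton] at hz
    exact absurd hz hzx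
  | @cons x x₁ y hx p' ih =>
    have hp' := hp
    rw [Walk.cons_isPath_iff] at hp'
    rw [Walk.support_cons, List.mem_cons] at hz
    rcases hz with hz | hz
    · exact absurd hz hzx
    have key : x₁ ≠ y → S.dist o x₁ < max (S.dist o x) (S.dist o y) := by
      intro hne
      rcases hS.dist_eq_dist_add_one_of_adj o hx with h | h
      · exact lt_max_of_lt_left (by omega)
      · have hlen := dist_eq_add_length_of_dist_snd hS o (Walk.cons hx p') hp
          (by rw [Walk.snd_cons]; exact h)
        have h1 : 1 ≤ p'.length := by
          cases p' with
          | nil => exact absurd rfl hne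
          | cons _ _ => simp
        rw [Walk.length_cons] at hlen
        exact lt_max_of_lt_right (by omega)
    by_cases hzx₁ : z = x₁
    · subst hzx₁
      exact key hzy
    · have hne : x₁ ≠ y := by
        rintro rfl
        have hnil := Walk.nil_iff_support_eq.mp (Walk.isPath_iff_nil.mp hp'.1)
        rw [hnil, List.mem_singleton] at hz
        exact hzx₁ hz
      calc S.dist o z < max (S.dist o x₁) (S.dist o y) := ih hp'.1 hz hzx₁ hzy
        _ ≤ max (S.dist o x) (S.dist o y) := max_le (key hne).le (le_max_right _ _)

/-- An interior node of a path has two distinct neighbours on the path.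
[cite: MochizukiSemiAnbd2006, Lem. 1.8 p.20] -/
theorem exists_adj_adj_of_mem_support {x y : V} (p : S.Walk x y) (hp : p.IsPath) {z : V}
    (hz : z ∈ p.support) (hzx : z ≠ x) (hzy : z ≠ y) :
    ∃ a c, a ∈ p.support ∧ c ∈ p.support ∧ a ≠ c ∧ S.Adj a z ∧ S.Adj z c := by
  induction p with
  | nil =>
    rw [Walk.support_nil, List.mem_singleton] at hz
    exact absurd hz hzx
  | @cons x x₁ y hx p' ih =>
    rw [Walk.cons_isPath_iff] at hp
    rw [Walk.support_cons, List.mem_cons] at hz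
    rcases hz with hz | hz
    · exact absurd hz hzx
    by_cases hzx₁ : z = x₁
    · subst hzx₁
      have hnil : ¬ p'.Nil := Walk.not_nil_of_ne hzy
      refine ⟨x, p'.snd, by simp, List.mem_cons_of_mem _ (p'.getVert_mem_support 1), ?_, hx,
        p'.adj_snd hnil⟩
      intro heq
      apply hp.2
      rw [heq]
      exact p'.getVert_mem_support 1
    · obtain ⟨a, c, ha, hc, hac, haz, hzc⟩ := ih hp.1 hz hzx₁ hzy
      exact ⟨a, c, List.mem_cons_of_mem _ ha, List.mem_cons_of_mem _ hc, hac, haz, hzc⟩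

/-- If, along a geodesic `p` from `a` to `a'` of a tree, the distance from a node `o` is minimal at
the end-point `a`, then `a` lies on a geodesic from `o` to `a'`.
[cite: MochizukiSemiAnbd2006, Lem. 1.8 p.20] -/
theorem exists_geodesic_through_of_min (hS : S.IsTree) (o : V) {a a' : V} (hne : a ≠ a')
    (p : S.Walk a a') (hp : p.IsPath)
    (hmin : ∀ z ∈ p.support, S.dist o a ≤ S.dist o z) :
    ∃ r : S.Walk o a', r.length = S.dist o a' ∧ a ∈ r.support := by
  have hnil : ¬ p.Nil := Walk.not_nil_of_ne hne
  have h1 : S.dist o p.snd = S.dist o a + 1 := by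
    rcases hS.dist_eq_dist_add_one_of_adj o (p.adj_snd hnil) with h | h
    · have h' := hmin p.snd (p.getVert_mem_support 1)
      omega
    · exact h
  have h2 := dist_eq_add_length_of_dist_snd hS o p hp h1
  obtain ⟨q, hql⟩ := hS.connected.exists_walk_length_eq_dist o a
  refine ⟨q.append p, ?_, ?_⟩
  · rw [Walk.length_append, hql, h2]
  · exact (Walk.mem_support_append_iff _ _).mpr (Or.inl q.end_mem_support)

/-- Fixed-point theorem for finite groups acting on trees ([SemiAnbd] Lemma 1.8 (ii)(a), "implicit in
the theory of [Serre]"), simple-graph form: a finite group acting on a tree by graph automorphisms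
moves some node `x` only to itself or to a neighbour of `x` (the node minimising the radius of an
orbit).  [cite: MochizukiSemiAnbd2006, Lem. 1.8(ii)(a) p.20] -/
theorem exists_forall_act_eq_or_adj (hS : S.IsTree) {Γ : Type*} [Group Γ] [Finite Γ]
    (act : Γ → V → V) (act_one : ∀ x, act 1 x = x)
    (act_mul : ∀ γ δ x, act (γ * δ) x = act γ (act δ x))
    (act_adj : ∀ γ {x y : V}, S.Adj x y → S.Adj (act γ x) (act γ y)) :
    ∃ x : V, ∀ γ : Γ, act γ x = x ∨ S.Adj (act γ x) x := by
  classical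
  haveI := Fintype.ofFinite Γ
  let f : Γ → S →g S := fun γ => ⟨act γ, fun h => act_adj γ h⟩
  have act_inv : ∀ γ x, act γ⁻¹ (act γ x) = x := fun γ x => by
    rw [← act_mul, inv_mul_cancel, act_one]
  have hdist : ∀ γ x y, S.dist (act γ x) (act γ y) = S.dist x y := by
    have hle : ∀ γ x y, S.dist (act γ x) (act γ y) ≤ S.dist x y := by
      intro γ x y
      obtain ⟨p, hp⟩ := hS.connected.exists_walk_length_eq_dist x y
      have h := SimpleGraph.dist_le (p.map (f γ))
      rw [Walk.length_map] at h
      exact hp ▸ h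
    intro γ x y
    refine le_antisymm (hle γ x y) ?_
    have h := hle γ⁻¹ (act γ x) (act γ y)
    rwa [act_inv, act_inv] at h
  obtain ⟨v₀⟩ := hS.connected.nonempty
  -- the radius of the orbit of `v₀` seen from `x`
  let r : V → ℕ := fun x => Finset.univ.sup fun γ : Γ => S.dist (act γ v₀) x
  have hr_le : ∀ x γ, S.dist (act γ v₀) x ≤ r x := fun x γ =>
    Finset.le_sup (f := fun γ : Γ => S.dist (act γ v₀) x) (Finset.mem_univ γ)
  have hr_inv' : ∀ δ x, r (act δ x) ≤ r x := by
    intro δ x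
    apply Finset.sup_le
    intro γ _
    have h : act γ v₀ = act δ (act (δ⁻¹ * γ) v₀) := by rw [← act_mul, mul_inv_cancel_left]
    rw [h, hdist]
    exact hr_le x _
  have hr_inv : ∀ δ x, r (act δ x) = r x := fun δ x =>
    le_antisymm (hr_inv' δ x) (by simpa [act_inv] using hr_inv' δ⁻¹ (act δ x))
  -- a node of minimal radius
  have hex : ∃ n, ∃ x, r x = n := ⟨_, v₀, rfl⟩
  obtain ⟨x₀, hx₀⟩ := Nat.find_spec hex
  have hmin : ∀ x, r x₀ ≤ r x := fun x => by
    rw [hx₀]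
    exact Nat.find_min' hex ⟨x, rfl⟩
  refine ⟨x₀, fun γ => ?_⟩
  by_contra hcon
  rw [not_or] at hcon
  obtain ⟨p, hp, hpl⟩ := hS.connected.exists_path_of_dist (act γ x₀) x₀
  have hnil : ¬ p.Nil := Walk.not_nil_of_ne hcon.1
  have hzmem : p.snd ∈ p.support := p.getVert_mem_support 1
  have hzy : p.snd ≠ act γ x₀ := (p.adj_snd hnil).ne.symm
  have hzx : p.snd ≠ x₀ := by
    intro h
    apply hcon.2
    have hadj := p.adj_snd hnil
    rw [h] at hadj
    exact hadj
  have hry : r (act γ x₀) = r x₀ := hr_inv γ x₀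
  have hpos : 0 < r x₀ := by
    rcases Nat.eq_zero_or_pos (r x₀) with h0 | h0
    · exfalso
      have h1 : S.dist (act 1 v₀) x₀ = 0 := by have := hr_le x₀ 1; omega
      have h2 : S.dist (act 1 v₀) (act γ x₀) = 0 := by have := hr_le (act γ x₀) 1; omega
      rw [act_one, hS.connected.dist_eq_zero_iff] at h1 h2
      exact hcon.1 (h2.symm.trans h1)
    · exact h0
  have hlt : r p.snd < r x₀ := by
    rw [Finset.sup_lt_iff (bot_le.trans_lt hpos)]
    intro δ _
    calc S.dist (act δ v₀) p.snd
        < max (S.dist (act δ v₀) (act γ x₀)) (S.dist (act δ v₀) x₀) :=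
          dist_lt_max_of_mem_support hS _ p hp hzmem hzy hzx
      _ ≤ max (r (act γ x₀)) (r x₀) := max_le_max (hr_le _ δ) (hr_le x₀ δ)
      _ = r x₀ := by rw [hry, max_self]
  exact absurd (hmin p.snd) (not_le.mpr hlt)

end Literature.AnabelianGeometry.SemiGraphs
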